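import Literature.MathematicalPhysics.QuantumFieldTheory.Balaban1983to89.B7Eq45TorusGaugeOrbit
import Literature.MathematicalPhysics.QuantumFieldTheory.Balaban1983to89.B9Eq335SmallBondsData
import Literature.MathematicalPhysics.QuantumFieldTheory.Balaban1983to89.B9Thm311GaugeOrbitClosed

/-!
# `Balaban1983to89.B9Thm311SmallPlaquettes` — T. Bałaban, *Propagators for lattice gauge theories in a background field*, Commun. Math. Phys. **99**
# (1985) 389–434 [Balaban1985BackgroundPropagators] Thm 3.11 p. 416 AT ITS PRINTED HYPOTHESIS (3.35) p. 396, read on the one-cube torus of the pub-balaban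
# NE9 chain: THM 3.11 «Δ_a IS POSITIVE DEFINITE» FOR THE CHAIN'S ASSEMBLED `Δ_a(U)` AT EVERY UNIT-BOUNDED UNITARY BACKGROUND `U` WHOSE PLAQUETTE
# VARIABLES AND CLOSED COORDINATE LINES ARE CLOSE TO `1` — the background displayed through GAUGE-INVARIANT data only, the structural witnesses of
# E162 (`hU1`, `hreg`, `hα1`) PRODUCED, with the volume-free constants `γ₁, ε₃` of the small-field ball

statement-level skeleton of published theorems with citation tags; proofs where landed; nothing here is a claim about the Yang–Mills mass gap

PDF held: `paper:balaban1985-cmp99-background-propagators` (journal page = PDF page + 388); p. 396 [PDF 8] and p. 416 [PDF 28] (text layer).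

THE PRINT (verbatim).  p. 396 (3.35): *«for an arbitrary cube □ of the described above class, and for a configuration U there exists a gauge
transformation u on □ such that U^u = e^{iηA}, and if the index of □ is j, then |A| < O(1)Mα₀(L^jη)⁻¹, |∇^ηA| < O(1)Mα₀(L^jη)⁻² on □, where O(1)M is a
size of □ in T_{L^{−j}}»*; p. 416, Thm 3.11: *«Under the assumptions of the Theorems 3.1–3.10 (i.e. for M sufficiently large and α₀ sufficiently small)
the operators Δ′_a, G′, (Q′G′Q′*)⁻¹, Δ_a, G are positive definite»*; (3.34) p. 396: *«Δ_a(U^u) = R(u)Δ_a(U)R(u⁻¹)»*.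
[Balaban1987RG1] (1.11)–(1.12) p. 262: *«|∂U − 1| < α₀ξ² on X, (1.11) for each cube □ ⊂ X of a size O(1)LM there exists a G-valued gauge transformation
u defined on □ and such, that U^u = exp iξA, |A|, |∇^ξA| < O(1)LMBα₀ on □, (1.12)»*.

WHY THIS FILE (cell context).  Thm 3.11 for the chain's `Δ_a(U)` (`B9Eq315QTorus.laplaceAofBackground`) exists in the tree (i) at a small FIELD in the
given gauge (`B9Thm311SmallFieldClosed(Uniform)`, `B9Eq335SmallBondsData`: binders {`U(b) ∈ U1`, `‖U(b) − 1‖ ≤ ε`, `hRS` ∕ unitary}) and (ii) on the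
`U1`-gauge ORBIT of that ball (`B9Thm311GaugeOrbitClosed`, this lineage gen 60: background `V = U^u`, binders at `U`).  Print's hypothesis is neither:
it is the GAUGE-INVARIANT class (3.35) ∕ (1.11)–(1.12) — small plaquette variables and, per cube, SOME small gauge.  On the chain's one-cube torus the
sibling files (A1) `B7Eq44TorusAxialGauge` ∕ (A2) `B7Eq45TorusGaugeOrbit` construct that gauge (the torus axial gauge) from «all plaquette variables
`δ`-close AND all closed coordinate lines `θ`-close to `1`» — the torus form of (1.11), the closed lines being forced by the wrap (sibling no-go).
This file states Thm 3.11 AT SUCH `U` ITSELF: the hypotheses are the gauge-invariant numbers `δ, θ` (and unitarity), the conclusion is the coercivity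
of `Δ_a(U)` in `U`'s own gauge, with E162's structural witnesses PRODUCED (`perCfg_mem_U1`, `hreg_of_small_plaquettes` below) — the shape the
`Support/NE9CurChart*` hosts consume (proof-irrelevant slots).

WHAT IS PROVED (sorry-free; 0 def; no `Prop` placeholder).
* **`hreg_of_small_plaquettes`** — E162's block-regularity letter READ OFF THE GAUGE-INVARIANT DATA: for unit-bounded `U` on `T_{L·m}` with
  `L·m_i ≤ N`, plaquettes `≤ δ`, closed lines `≤ θ` and `d(N−1)²δ + θ ≤ ε`: `‖W_{c,x}(Ũ) − 1‖ ≤ 2(d+1)L·ε` (the block contours are closed ⇒ their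
  deviation is gauge invariant: (A2) `exists_small_bond_gauge` + `B9Eq333ProjectionCovariance.hreg_gaugeU` + `B9Eq335SmallBondsData.hreg_of_small_bonds`).
* **`exists_coercive_laplaceA_of_small_plaquettes_unitary`** — [B9] THM 3.11 AT THE PLAQUETTE CLASS: ONE pair `γ₁, ε₃ > 0` (those of
  `B9Thm311GaugeOrbitClosed`) such that on EVERY lattice `T_{L·m}`, for EVERY unit-bounded unitary `U` with plaquettes `≤ δ`, closed lines `≤ θ`,
  `d(N−1)²δ + θ ≤ ε ≤ min(ε₃, ε_reg(d,L))`: `γ₁‖x‖² ≤ re⟨x, Δ_a(U)x⟩` — `Δ_a(U)` at `U` in its GIVEN gauge, structural slots produced.  MECHANISM: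
  (A2) `exists_small_bond_gauge_unitary` writes `U = V^{g′}` (`V` small-bond unitary, `g′` unitary `U1`-valued); `obtain ⟨V, g′, …, rfl⟩`; then
  `B9Thm311GaugeOrbitClosed.exists_coercive_laplaceA_of_gaugeOrbit_small_field_uniform` at `(V, g′)` with `hRS`, `hτ`, `hAd` discharged by the model
  letters (`hRS_of_unitary`, `tau_AdA_of_trace`, `inner_AdW_AdW_of_compat`) IS the goal by proof irrelevance of the structural slots.
* **`laplaceAofBackground_pos_of_small_plaquettes_unitary`** — the `hpos` slot: `0 < re⟨x, Δ_a(U)x⟩` for `x ≠ 0`, same hypotheses.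
MODEL / DECLARED READINGS.  (M1) the E162 one-level periodic model (`B9Eq315QTorus`), fibre read along `φ`, tracial `τ` with the norming
`⟨φ⁻¹X, φ⁻¹Y⟩ = τ(X*Y)`; (M2) hypotheses: `U(b) ∈ U1`, `U(b)* = U(b)⁻¹`, ALL plaquettes `δ`-close and ALL closed coordinate lines `θ`-close to `1`
(the second is the torus's price for print's non-wrapping cube — sibling no-go `B7Eq45TorusGaugeOrbit.not_small_bond_orbit_slice`); (M3) `γ₁, ε₃`
volume-free finite-lattice numbers of `B9Thm311SmallFieldClosedUniform` (depend on `d, L, η, c₀, c₁, a, M_φ, M_φ′, C_τ`), the admissible `δ, θ` shrink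
like `(d(N−1)²)⁻¹` with the period — NOT print's per-cube `O(1)Mα₀` uniform in the lattice (Thms 3.12–3.13), NOT the multi-level operators, NOT the
p. 416 per-cube locality reduction.
HONEST SCOPE.  Composition of landed theorems + the sibling axial-gauge construction; no inequality of the paper proved beyond what the tree proves; NOT
summit progress (cell pub-balaban: NE9 NOT PRINTED / NOT PROVED; «NE9 ⇐ the named binders»; spine PROVED 0/9; HONEST DEPENDENCY: continuum YM on T⁴ ⇐
BetaPertH ∧ nine spine estimates (0/9 proved); BetaPertH ⇐ (D1) ∧ (D4) ∧ CAP+tail; G-an2-4 gates asym, D1 and NE2/3/4).  Unit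
`b2b-balaban-t4-ne9-formalise-leaf-03` (NE9 crux-team leaf prover, gen 61), INTENT I-ne9leaf03-g61-1 file (A2b); NEW file; modifies nothing.  Net new
unproved facts: 0.
-/

noncomputable section

open scoped InnerProductSpace

namespace Literature.MathematicalPhysics.QuantumFieldTheory.Balaban1983to89.B9Thm311SmallPlaquettes

open B4Sect5Torus (TSite)
open B9SectCLatticeCarrier (Bond)
open B7Prop1Explicit (U1 Wcx boxVec)
open B9Eq319QprimeTorus (fineP)
open B11Eq103H1Complex (BondL2K)
open B9Eq310HessianOperator (adTransportW)
open B9Eq310DeltaPrime (plaqHolU)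
open B9Eq315QTorus (perCfg cornerSite laplaceAofBackground)
open B9Eq328GaugeAction (gaugeU AdA AdW tau_AdA_of_trace inner_AdW_AdW_of_compat)
open B9Eq333ProjectionCovariance (hU1_gaugeU hreg_gaugeU)
open B9Eq335SmallBondsData (perCfg_mem_U1 hreg_of_small_bonds alpha_le_64)
open B9Thm311SmallFieldClosed (hRS_of_unitary)
open B9Thm311GaugeOrbitClosed (exists_coercive_laplaceA_of_gaugeOrbit_small_field_uniform)
open B7Eq44TorusAxialGauge (lineHolT)
open B7Eq45TorusGaugeOrbit (exists_small_bond_gauge exists_small_bond_gauge_unitary)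

variable {d : ℕ} (L : ℕ) [NeZero L] (m : Fin d → ℕ) [∀ i, NeZero (fineP L m i)]
  {𝔸 : Type*} [NormedRing 𝔸] [NormedAlgebra ℂ 𝔸] [CompleteSpace 𝔸] [NormOneClass 𝔸] [StarRing 𝔸] [NormedStarGroup 𝔸] [StarModule ℂ 𝔸]

/-! ## §1 E162's block-regularity letter read off the gauge-invariant data -/

section Reg

variable {U : Bond d (fineP L m) → 𝔸ˣ} (hU : ∀ b, U b ∈ U1 𝔸) {N : ℕ} (hN : ∀ i, fineP L m i ≤ N) {δ : ℝ} (hδ0 : 0 ≤ δ)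
  (hδ : ∀ p : B9SectCLatticeCarrier.Plaq d (fineP L m), ‖(plaqHolU U p : 𝔸) - 1‖ ≤ δ) {θ : ℝ} (hθ0 : 0 ≤ θ)
  (hθ : ∀ (x : TSite d (fineP L m)) (μ : Fin d), ‖((lineHolT (fineP L m) U x μ : 𝔸ˣ) : 𝔸) - 1‖ ≤ θ) {ε : ℝ} (hε : 0 ≤ ε)
  (hεb : (d : ℝ) * ((N : ℝ) - 1) ^ 2 * δ + θ ≤ ε)

omit [NeZero L] [CompleteSpace 𝔸] [StarRing 𝔸] [NormedStarGroup 𝔸] [StarModule ℂ 𝔸] in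
include hU hN hδ0 hδ hθ0 hθ hε hεb in
/-- **E162's `hreg` READ OFF PLAQUETTES AND CLOSED LINES**: for a unit-bounded torus field with `L·m_i ≤ N`, all plaquette variables `δ`-close and all
closed coordinate lines `θ`-close to `1`, and `d(N−1)²δ + θ ≤ ε`, every block contour holonomy `W_{c,x}(Ũ)` of the periodic extension is `2(d+1)L·ε`-close
to `1` — `U = V^{g′}` with `V` `ε`-small-bond (`B7Eq45TorusGaugeOrbit.exists_small_bond_gauge`), the letter for `V` (`hreg_of_small_bonds`) and its
transfer along the `U1`-gauge `g′` (`hreg_gaugeU`: closed contours are conjugated). [cite: Balaban1985BackgroundPropagators, (3.35) p.396; Balaban1985Averaging, (42) p.23, (45) p.24] -/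
theorem hreg_of_small_plaquettes (y : TSite d m) (κ : Fin d) (r : Fin d → Fin L) :
    ‖((Wcx L (perCfg (fineP L m) U) (cornerSite L y) κ (boxVec L r) : 𝔸ˣ) : 𝔸) - 1‖ ≤ 2 * (d + 1) * L * ε := by
  obtain ⟨V, g', hV, hVε, hg', rfl⟩ := exists_small_bond_gauge (fineP L m) hU hN hδ0 hδ hθ0 hθ
  exact hreg_gaugeU L m g' V hg' (hreg_of_small_bonds L m hV hε fun b => (hVε b).trans hεb) y κ r

end Reg

/-! ## §2 [B9] Thm 3.11 at the plaquette class: coercivity and positivity of `Δ_a(U)` in `U`'s own gauge -/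

section Thm311

variable (hL : 1 ≤ L) {W : Type*} [NormedAddCommGroup W] [InnerProductSpace ℂ W] [FiniteDimensional ℂ W] (φ : W ≃ₗ[ℂ] 𝔸) {c₀ c₁ : ℝ} [Fact (0 < c₀)]
  [Fact (0 < c₁)] (τ : 𝔸 →ₗ[ℂ] ℂ)

/-- **[B9] THM 3.11 «Δ_a IS POSITIVE DEFINITE» AT EVERY UNIT-BOUNDED UNITARY BACKGROUND WITH SMALL PLAQUETTE VARIABLES AND SMALL CLOSED COORDINATE
LINES** — print's hypothesis (3.35) («there exists a gauge transformation u on □ such that U^u … small») on the chain's one-cube torus, the gauge NOT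
given but CONSTRUCTED (the torus axial gauge of `B7Eq44TorusAxialGauge`): ONE pair `γ₁, ε₃ > 0` such that on EVERY lattice `T_{L·m}`, for every `U` with
`U(b) ∈ U1`, `U(b)* = U(b)⁻¹`, `‖U(∂p) − 1‖ ≤ δ` (all plaquettes), `‖U(C_{x,μ}) − 1‖ ≤ θ` (all closed lines), `L·m_i ≤ N` and `d(N−1)²δ + θ ≤ ε ≤ ε₃`,
`ε ≤ ε_reg(d, L)`: `γ₁‖x‖² ≤ re⟨x, Δ_a(U)x⟩`, the operator taken AT `U` with E162's structural slots PRODUCED (`alpha_le_64`, `perCfg_mem_U1`,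
`hreg_of_small_plaquettes`).  Mechanism: `U = V^{g′}` (`exists_small_bond_gauge_unitary`), then `B9Thm311GaugeOrbitClosed` at `(V, g′)` with `hRS`, `hτ`,
`hAd` from the model letters; the structural slots agree by proof irrelevance. [cite: Balaban1985BackgroundPropagators, Thm 3.11 p.416, (3.34)–(3.35) p.396; Balaban1987RG1, (1.11)–(1.12) p.262] -/
theorem exists_coercive_laplaceA_of_small_plaquettes_unitary {η : ℝ} (hη : η ≠ 0) {a : ℝ} (ha : 0 < a) {Mφ Mφ' : ℝ} (hMφ : 0 ≤ Mφ)
    (hMφ' : 0 ≤ Mφ') (hφ : ∀ w, ‖φ w‖ ≤ Mφ * ‖w‖) (hφ' : ∀ X, ‖φ.symm X‖ ≤ Mφ' * ‖X‖) {Cτ : ℝ} (hτC : ∀ X, ‖τ X‖ ≤ Cτ * ‖X‖)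
    (hCτ : 0 ≤ Cτ) (hτφ : ∀ X Y : 𝔸, ⟪φ.symm X, φ.symm Y⟫_ℂ = τ (star X * Y)) (htr : ∀ X Y : 𝔸, τ (X * Y) = τ (Y * X)) :
    ∃ γ₁ ε₃ : ℝ, 0 < γ₁ ∧ 0 < ε₃ ∧ ∀ (m : Fin d → ℕ) [∀ i, NeZero (fineP L m i)]
      (U : Bond d (fineP L m) → 𝔸ˣ) (hU : ∀ b, U b ∈ U1 𝔸), (∀ b, star (U b : 𝔸) = (((U b)⁻¹ : 𝔸ˣ) : 𝔸)) →
      ∀ {N : ℕ} (hN : ∀ i, fineP L m i ≤ N) {δ : ℝ} (hδ0 : 0 ≤ δ) (hδ : ∀ p : B9SectCLatticeCarrier.Plaq d (fineP L m), ‖(plaqHolU U p : 𝔸) - 1‖ ≤ δ)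
        {θ : ℝ} (hθ0 : 0 ≤ θ) (hθ : ∀ (x : TSite d (fineP L m)) (μ : Fin d), ‖((lineHolT (fineP L m) U x μ : 𝔸ˣ) : 𝔸) - 1‖ ≤ θ)
        {ε : ℝ} (hε : 0 ≤ ε) (hεb : (d : ℝ) * ((N : ℝ) - 1) ^ 2 * δ + θ ≤ ε)
        (hεr : ε ≤ 1 / (256 * ((d : ℝ) + 1) ^ 2 * (L : ℝ) ^ (d + 1))), ε ≤ ε₃ →
        ∀ x : BondL2K ℂ d (fineP L m) c₀ W, γ₁ * ‖x‖ ^ 2 ≤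
          RCLike.re ⟪x, laplaceAofBackground L m hL φ U (alpha_le_64 hL hε hεr) (perCfg_mem_U1 L m hU)
            (hreg_of_small_plaquettes L m hU hN hδ0 hδ hθ0 hθ hε hεb) τ η (c₀ := c₀) (c₁ := c₁) a x⟫_ℂ := by
  obtain ⟨γ₁, ε₃, hγ₁, hε₃, H⟩ :=
    exists_coercive_laplaceA_of_gaugeOrbit_small_field_uniform L hL φ τ (c₀ := c₀) (c₁ := c₁) hη ha hMφ hMφ' hφ hφ' hτC hCτ
  refine ⟨γ₁, ε₃, hγ₁, hε₃, fun m _ U hU hUstar N hN δ hδ0 hδ θ hθ0 hθ ε hε hεb hεr hεε₃ x => ?_⟩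
  obtain ⟨V, g', hV, hVstar, hVε, hg', hg'star, rfl⟩ := exists_small_bond_gauge_unitary (fineP L m) hU hN hδ0 hδ hθ0 hθ hUstar
  have hτg : ∀ (y : TSite d (fineP L m)) (X : 𝔸), τ (AdA (g' y) X) = τ X := fun y X => tau_AdA_of_trace τ htr (g' y) X
  exact H m V (alpha_le_64 hL hε hεr) (perCfg_mem_U1 L m hV) (hreg_of_small_bonds L m hV hε fun b => (hVε b).trans hεb) hε hεε₃
    (fun b => (hVε b).trans hεb) (hRS_of_unitary φ τ hτφ htr V hVstar) g' hg' hg'star hτg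
    (fun y v v' => inner_AdW_AdW_of_compat φ τ hτφ (hτg y) (hg'star y) v v') x

/-- **THE `hpos` SLOT OF THE CHAIN'S LETTERS AT THE PLAQUETTE CLASS**: `0 < re⟨x, Δ_a(U)x⟩` for `x ≠ 0`, same hypotheses and slots as the coercivity
above. [cite: Balaban1985BackgroundPropagators, Thm 3.11 p.416, (3.35) p.396] -/
theorem laplaceAofBackground_pos_of_small_plaquettes_unitary {η : ℝ} (hη : η ≠ 0) {a : ℝ} (ha : 0 < a) {Mφ Mφ' : ℝ} (hMφ : 0 ≤ Mφ)
    (hMφ' : 0 ≤ Mφ') (hφ : ∀ w, ‖φ w‖ ≤ Mφ * ‖w‖) (hφ' : ∀ X, ‖φ.symm X‖ ≤ Mφ' * ‖X‖) {Cτ : ℝ} (hτC : ∀ X, ‖τ X‖ ≤ Cτ * ‖X‖)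
    (hCτ : 0 ≤ Cτ) (hτφ : ∀ X Y : 𝔸, ⟪φ.symm X, φ.symm Y⟫_ℂ = τ (star X * Y)) (htr : ∀ X Y : 𝔸, τ (X * Y) = τ (Y * X)) :
    ∃ ε₃ : ℝ, 0 < ε₃ ∧ ∀ (m : Fin d → ℕ) [∀ i, NeZero (fineP L m i)]
      (U : Bond d (fineP L m) → 𝔸ˣ) (hU : ∀ b, U b ∈ U1 𝔸), (∀ b, star (U b : 𝔸) = (((U b)⁻¹ : 𝔸ˣ) : 𝔸)) →
      ∀ {N : ℕ} (hN : ∀ i, fineP L m i ≤ N) {δ : ℝ} (hδ0 : 0 ≤ δ) (hδ : ∀ p : B9SectCLatticeCarrier.Plaq d (fineP L m), ‖(plaqHolU U p : 𝔸) - 1‖ ≤ δ)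
        {θ : ℝ} (hθ0 : 0 ≤ θ) (hθ : ∀ (x : TSite d (fineP L m)) (μ : Fin d), ‖((lineHolT (fineP L m) U x μ : 𝔸ˣ) : 𝔸) - 1‖ ≤ θ)
        {ε : ℝ} (hε : 0 ≤ ε) (hεb : (d : ℝ) * ((N : ℝ) - 1) ^ 2 * δ + θ ≤ ε)
        (hεr : ε ≤ 1 / (256 * ((d : ℝ) + 1) ^ 2 * (L : ℝ) ^ (d + 1))), ε ≤ ε₃ →
        ∀ x : BondL2K ℂ d (fineP L m) c₀ W, x ≠ 0 →
          0 < RCLike.re ⟪x, laplaceAofBackground L m hL φ U (alpha_le_64 hL hε hεr) (perCfg_mem_U1 L m hU)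
            (hreg_of_small_plaquettes L m hU hN hδ0 hδ hθ0 hθ hε hεb) τ η (c₀ := c₀) (c₁ := c₁) a x⟫_ℂ := by
  obtain ⟨γ₁, ε₃, hγ₁, hε₃, H⟩ :=
    exists_coercive_laplaceA_of_small_plaquettes_unitary L hL φ τ (c₀ := c₀) (c₁ := c₁) hη ha hMφ hMφ' hφ hφ' hτC hCτ hτφ htr
  refine ⟨ε₃, hε₃, fun m _ U hU hUstar N hN δ hδ0 hδ θ hθ0 hθ ε hε hεb hεr hεε₃ x hx => ?_⟩
  have h := H m U hU hUstar hN hδ0 hδ hθ0 hθ hε hεb hεr hεε₃ x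
  have hx' : 0 < ‖x‖ ^ 2 := by positivity
  nlinarith

end Thm311

end Literature.MathematicalPhysics.QuantumFieldTheory.Balaban1983to89.B9Thm311SmallPlaquettes

end
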